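import Summits.AnomalousDissipation.AnomalousDissipation.Theorems.MarginalStabilityChainStrainedLayerLawClockMeanDissipationFaces
import HarnessLib

/-!
# Crux `MarginalStabilityChain.StrainedLayerLaw` (stmt-AnomalousDissipation-3007), line `FirstLemmasR2K4`
# (log-enstrophy clock + Nash roundness): the enstrophy mean floor is NECESSARY

Support file (`--supports stmt-AnomalousDissipation-3007`; registered sub-goal
`enstrophyMeanFloor_of_meanLayerDissipation` of line `FirstLemmasR2K4`, lead c7, wave 3).

What it proves: for ONE classical solution `(u, v, p)` of the stretched layer class on `(0, ∞)` (viscosity `ν > 0`,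
period `L > 0`) with shear tails on every compact time window `[a, b] ⊂ (0, ∞)` and locally finite dissipation
(`∫⁻_{(0,T]} D < ∞` for every `T > 0`), a mean-dissipation floor `ofReal K ≤ meanLayerDissipation ν L u v` (`K ≥ 0`;
`meanLayerDissipation = liminf_T ofReal T⁻¹ · ∫⁻_{(0,T]} D`, `meanLayerDissipation_def`) forces, for every `K' < K`,
the eventual ENSTROPHY MEAN FLOOR `L K' T ≤ ν ∫_1^T Ω` (`Ω(τ) = ∫_{(0,L]} ∫_ℝ ω(τ)²`, iterated form). Together with the
neighbouring reduction `StrainedLayerLaw_of_enstrophyMeanFloor` this shows that, restricted to tailed finite-dissipation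
members, the crux IS an enstrophy mean floor.

How: if `K' < 0` the left side is negative and `∫_1^T Ω ≥ 0`. Otherwise pick `K' < K'' < K`; `ofReal K'' < liminf` gives
`ofReal K'' < ofReal T⁻¹ · ∫⁻_{(0,T]} D` eventually (`Filter.eventually_lt_of_lt_liminf`); split the window
`(0,T] = (0,1] ∪ (1,T]` (`lintegral_union`): the head `a₀ = (∫⁻_{(0,1]} D).toReal` is a finite constant and the tail is
`ν ∫_1^T Ω / L` by the landed enstrophy face `faces_enstrophy` (`…ClockMeanDissipationFaces.lean`); unwrapping the
`ℝ≥0∞` inequality gives `K'' T < a₀ + ν ∫_1^T Ω / L`, whence `L K' T ≤ ν ∫_1^T Ω` once `T ≥ a₀ / (K'' − K')`.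
No facts are asserted.
-/

-- `Summit.<Summit>.<Problem>` is the tree's mandated summit-side namespace (CONVENTIONS §2); for this
-- single-conjunct summit the two coincide, so the duplicate is deliberate.
set_option linter.dupNamespace false

noncomputable section

open scoped Topology ENNReal
open Filter Set Function MeasureTheory

namespace Summit.AnomalousDissipation.AnomalousDissipation.Theorems.StrainedLayerLaw.LogEnstrophyClock

open Literature.Analysis.FluidPDE Literature.Analysis.FluidPDE.StretchedLayer
open Summit.AnomalousDissipation.AnomalousDissipation.Theses.MarginalStabilityChain
open Summit.AnomalousDissipation.AnomalousDissipation.Theorems.StrainedLayerLaw.StrainWorkSumRule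

/-- Splitting the dissipation of the window `(0, T]` at time `1` (`T ≥ 1`):
`∫⁻_{(0,T]} D = ∫⁻_{(0,1]} D + ∫⁻_{(1,T]} D`. [folklore] -/
theorem enstrophyMeanFloor_lintegral_split (D : ℝ → ℝ≥0∞) {T : ℝ} (hT : 1 ≤ T) :
    ∫⁻ t in Ioc 0 T, D t = (∫⁻ t in Ioc 0 1, D t) + ∫⁻ t in Ioc 1 T, D t := by
  rw [← Ioc_union_Ioc_eq_Ioc zero_le_one hT]
  exact lintegral_union measurableSet_Ioc (Ioc_disjoint_Ioc_of_le le_rfl)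

/-- The real bookkeeping step: from `K'' T < a₀ + b`, `a₀ ≤ (K'' − K') T` and `L > 0` conclude `L K' T ≤ L b`.
[folklore] -/
theorem enstrophyMeanFloor_real_step {L K' K'' T a₀ b : ℝ} (hL : 0 < L) (h1 : K'' * T < a₀ + b)
    (h2 : a₀ ≤ (K'' - K') * T) : L * K' * T ≤ L * b := by
  have h3 : K' * T ≤ b := by nlinarith
  calc L * K' * T = L * (K' * T) := by ring
    _ ≤ L * b := mul_le_mul_of_nonneg_left h3 hL.le

/-- **The enstrophy mean floor is necessary (registered sub-goal of line `FirstLemmasR2K4`).** For one classical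
solution of the stretched layer class on `(0, ∞)` with shear tails on every `[a, b] ⊂ (0, ∞)` and locally finite
dissipation, a mean-dissipation floor `ofReal K ≤ meanLayerDissipation ν L u v` (`K ≥ 0`) forces, for every `K' < K`,
eventually `L K' T ≤ ν ∫_1^T Ω` (iterated enstrophy). Liminf ⇒ eventually (`Filter.eventually_lt_of_lt_liminf`), the
window split `(0,T] = (0,1] ∪ (1,T]` with a finite head, and the enstrophy face `faces_enstrophy` on the tail.
[folklore] -/
theorem enstrophyMeanFloor_of_meanLayerDissipation : ∀ (ν L K : ℝ), 0 < ν → 0 < L → 0 ≤ K → ∀ (u v p : ℝ → ℝ → ℝ → ℝ), IsStretchedLayerNSSolutionOn (Ioi 0) ν 1 1 L u v p → (∀ a b : ℝ, 0 < a → a < b → ExpTails (Icc a b) u v) → (∀ T : ℝ, 0 < T → ∫⁻ t in Ioc 0 T, layerDissipation ν L (u t) (v t) ≠ ∞) → ENNReal.ofReal K ≤ meanLayerDissipation ν L u v → ∀ K' : ℝ, K' < K → ∀ᶠ T : ℝ in atTop, L * K' * T ≤ ν * ∫ τ in (1:ℝ)..T, (∫ x in Ioc 0 L, ∫ y, vorticity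 (u τ) (v τ) x y ^ 2) := by
  intro ν L K hν hL _hK u v p hsol htails hfin hfloor K' hK'
  set Ω : ℝ → ℝ := fun τ => ∫ x in Ioc 0 L, ∫ y, vorticity (u τ) (v τ) x y ^ 2 with hΩ
  have hΩnn : ∀ τ, 0 ≤ Ω τ := fun τ => integral_nonneg fun x => integral_nonneg fun y => sq_nonneg _
  have hInn : ∀ T : ℝ, 1 ≤ T → 0 ≤ ∫ τ in (1:ℝ)..T, Ω τ := fun T hT =>
    intervalIntegral.integral_nonneg hT fun τ _ => hΩnn τ
  rcases lt_or_ge K' 0 with hK'neg | hK'nn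
  · -- negative floors are free
    filter_upwards [eventually_ge_atTop (1:ℝ)] with T hT
    have h1 : L * K' * T ≤ 0 := by
      have : L * K' < 0 := mul_neg_of_pos_of_neg hL hK'neg
      nlinarith
    exact h1.trans (mul_nonneg hν.le (hInn T hT))
  -- main case `0 ≤ K' < K`: an intermediate level `K''`
  have hKpos : 0 < K := hK'nn.trans_lt hK'
  set K'' : ℝ := (K' + K) / 2 with hK''
  have hK'K'' : K' < K'' := by rw [hK'']; linarith
  have hK''K : K'' < K := by rw [hK'']; linarith
  have hK''nn : 0 ≤ K'' := hK'nn.trans hK'K''.le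
  -- the finite head `(0, 1]`
  have hA : ∫⁻ t in Ioc 0 1, layerDissipation ν L (u t) (v t) ≠ ∞ := hfin 1 one_pos
  set a₀ : ℝ := (∫⁻ t in Ioc 0 1, layerDissipation ν L (u t) (v t)).toReal with ha₀
  have ha₀nn : 0 ≤ a₀ := ENNReal.toReal_nonneg
  -- liminf ⇒ eventually
  have hlim : ENNReal.ofReal K'' <
      liminf (fun T : ℝ => ENNReal.ofReal T⁻¹ * ∫⁻ t in Ioc 0 T, layerDissipation ν L (u t) (v t)) atTop := by
    rw [← meanLayerDissipation_def]
    exact lt_of_lt_of_le ((ENNReal.ofReal_lt_ofReal_iff hKpos).2 hK''K) hfloor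
  have hev : ∀ᶠ T : ℝ in atTop,
      ENNReal.ofReal K'' < ENNReal.ofReal T⁻¹ * ∫⁻ t in Ioc 0 T, layerDissipation ν L (u t) (v t) :=
    Filter.eventually_lt_of_lt_liminf hlim
  filter_upwards [hev, eventually_gt_atTop (1:ℝ), eventually_ge_atTop (a₀ / (K'' - K'))] with T hT hT1 hTge
  have hT0 : 0 < T := one_pos.trans hT1
  -- split the window and name the tail
  have hsplit := enstrophyMeanFloor_lintegral_split (fun t => layerDissipation ν L (u t) (v t)) hT1.le
  have hB : ∫⁻ t in Ioc 1 T, layerDissipation ν L (u t) (v t) ≠ ∞ := by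
    have h := hfin T hT0
    rw [hsplit] at h
    exact (ENNReal.add_ne_top.1 h).2
  set b : ℝ := (∫⁻ t in Ioc 1 T, layerDissipation ν L (u t) (v t)).toReal with hb
  have hbnn : 0 ≤ b := ENNReal.toReal_nonneg
  have hface : L * b = ν * ∫ τ in (1:ℝ)..T, Ω τ := faces_enstrophy hν hL hsol htails hT1
  -- unwrap the `ℝ≥0∞` inequality
  have h1 : ENNReal.ofReal T⁻¹ * ∫⁻ t in Ioc 0 T, layerDissipation ν L (u t) (v t) =
      ENNReal.ofReal (T⁻¹ * (a₀ + b)) := by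
    rw [hsplit, ← ENNReal.ofReal_toReal hA, ← ENNReal.ofReal_toReal hB, ← ENNReal.ofReal_add ha₀nn hbnn,
      ← ENNReal.ofReal_mul (inv_nonneg.2 hT0.le)]
  rw [h1] at hT
  have hreal : K'' < T⁻¹ * (a₀ + b) := (ENNReal.ofReal_lt_ofReal_iff_of_nonneg hK''nn).1 hT
  have h2 : K'' * T < a₀ + b := by
    have h := mul_lt_mul_of_pos_right hreal hT0
    have h' : T⁻¹ * (a₀ + b) * T = a₀ + b := by field_simp
    linarith
  have h3 : a₀ ≤ (K'' - K') * T := by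
    have h := (div_le_iff₀ (sub_pos.2 hK'K'')).1 hTge
    linarith
  calc L * K' * T ≤ L * b := enstrophyMeanFloor_real_step hL h2 h3
    _ = ν * ∫ τ in (1:ℝ)..T, Ω τ := hface
end Summit.AnomalousDissipation.AnomalousDissipation.Theorems.StrainedLayerLaw.LogEnstrophyClock

end
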